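import Literature.NumberTheory.Automorphic.Liu2021.SplitPlaceMixedModel
import Literature.NumberTheory.GelbartRogawski1991.LocalDoubledUnitarySplittingDataSplit
import Literature.NumberTheory.GelbartRogawski1991.LocalKudlaSplittingRigiditySplit
import Literature.RepresentationTheory.HeisenbergGroup.LeraySectionStabiliserAgreement
import HarnessLib

/-!
# The Weil representation of the split datum of the doubled unitary group is the mixed model twisted by `χ_w(det)⁻¹`
# ([Kudla1994, Thm 3.1]; [HarrisKudlaSweet1996, §1 (1.15)–(1.16)]; [MoeglinVignerasWaldspurger1987, Chap. 3 III.1])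

Topic `NumberTheory/GelbartRogawski1991`; namespace
`Literature.NumberTheory.GelbartRogawski1991.UnitaryDualPair.LocalSplitting`. KERNEL ONLY: theorems; no definition,
no named fact, no `sorry`.

Setting of `LocalDoubledUnitarySplittingDataSplit` (the split half of the local splitting data of the doubled group
`H = U(𝕍 ⊕ −𝕍)`, [Kudla1994, Thm 3.1]): `E/F` quadratic with `c`, `δ`, a finite place `v` of `F` SPLIT in `E`
(`w ∣ v`, `c • w ≠ w`), `T₀ ∈ M_n(F)` symmetric non-degenerate (here diagonal, `0 < n`), `J^𝔻 = T^𝔻 ⊗ 1`,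
`T^𝔻 = T₀ ⊕ (−T₀)`, local characters `χv` above `v` tied by `IsSplitPair` and trivial near `1`, and the split datum
`D = localSplittingDatumSplit … χv` with splitting function `β(g) = λ_Δ(ι g) · χ_w(det g_w)` and Weil representation
`ω_D(g) = β(g)⁻¹ r_Δ(ι g)` on `𝒮(F_v^{n+n})` (`r_Δ` Rao's Leray-normalised section at `ℓ_Δ`).

MAIN RESULT (`localOmega_localSplittingDatumSplit_symm_map`). Let `E ∈ Sp(𝕎^𝔻_v)` conjugate the split group onto
the Siegel Levi, `ι^𝔻_v(κ_A) = E⁻¹ m(A⁻ᵀ) E` for all `A ∈ GL_{n+n}(F_v)` (`κ_A ∈ H(F_v)` the element of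
`w`-component `ι_w(A)`; such an `E` is `J_v γ_w`, the tree's `SplitPlaceMixedModel.iota_symm_map_eq_conj`), and let
`Γ` be ANY implementer of `E` on `𝒮(F_v^{n+n})`. Then for all `A` and `Φ`

  `ω_D(κ_A) Φ = χ_w(det ι_w(A))⁻¹ • Γ⁻¹ (r(m(A⁻ᵀ)) (Γ Φ))`,   `r(m(b)) Φ = |det b|^{-1/2} Φ(b⁻¹ ·)` (`leviOpPi`):

at a split place the Weil representation of Kudla's `χ`-splitting IS «`GL_{n+n}` acting linearly through
`Φ ↦ |det a|^{1/2} Φ(ᵗa ·)`, twisted by `χ_w(det)⁻¹`» ([HarrisKudlaSweet1996, §1 (1.16)];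
[MoeglinVignerasWaldspurger1987, Chap. 3 III.1]) — with NO further character. The inverse is the tree's convention
`ω = β⁻¹ r`, `β = λ_Δ · (χ_w ∘ det ∘ pr_w)`.

PROOF. §1 On the Siegel parabolic `P_Δ` the Leray section is the conjugated Levi operator EXACTLY:
`r_Δ(ι p) = Γ⁻¹ r(m(A⁻ᵀ)) Γ` for `p = κ_A ∈ P_Δ` — `ι p` fixes `ℓ_Δ` and `E⁻¹ℓ_Y` (because `E ι p E⁻¹ = m(A⁻ᵀ)`
fixes `ℓ_Y`), two Leray sections agree on a common stabiliser (`leraySection_apply_eq_of_map_eq`), the Leray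
section of `E⁻¹ℓ_Y` is the `Γ`-conjugate of that of `ℓ_Y` (`ImplementerSection.conjBy`), whose Levi values are
`leviOpPi` (`leraySection_apply_transportSp_levi`); no Weil index is evaluated. §2 As in the tree's
`exists_mixedModel`, `κ ↦ Γ⁻¹ r(m(A_κ⁻ᵀ)) Γ` is a second section over `ι^𝔻_v`, so `ω_D = η • (it)` for a character
`η` of `H(F_v)` (`MpPsi.exists_twist_toRep_comp_of_proj_eq`); on `P_Δ`, `β(p) = χ_w(det p_w)`
(`L1s_parabolic`, `chi_det_eq_chiDet`) and §1 give `η(p) χ_w(det p_w) = 1`; a character of `H(F_v)` trivial on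
`P_Δ` is trivial (`eq_one_of_forall_isSiegelDelta_eq_one_of_split`), so `η = (χ_w ∘ det ∘ pr_w)⁻¹`.

Written for the d6 line of the cell `hodgecm-mathlib` (card S4b-3: the mixed-model character of the undoubled
split datum, sequel `LocalUnitaryUndoublingSplitMixedModel`); nothing here is a claim of [Liu2021].

## References

* S. S. Kudla, *Splitting metaplectic covers of dual reductive pairs*, Israel J. Math. 87 (1994) 361–401, §3,
  Thm 3.1 [Kudla1994].
* M. Harris, S. S. Kudla, W. J. Sweet, *Theta dichotomy for unitary groups*, J. Amer. Math. Soc. 9 (1996)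
  941–1004, §1 (1.15)–(1.16) [HarrisKudlaSweet1996].
* C. Mœglin, M.-F. Vignéras, J.-L. Waldspurger, *Correspondances de Howe sur un corps p-adique*, LNM 1291
  (1987), Chap. 2 II.1–II.2, II.6; Chap. 3 III.1 [MoeglinVignerasWaldspurger1987].
* R. Ranga Rao, Pacific J. Math. 157 (1993), Thm 4.1, Lemma 5.1 [Rangarao1993].
-/

set_option autoImplicit false

noncomputable section

open NumberField IsDedekindDomain MeasureTheory Matrix
open Literature.RepresentationTheory.HeisenbergGroup Literature.RepresentationTheory.HeisenbergGroup.SymplecticMatrix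
open Literature.NumberTheory.Automorphic Literature.NumberTheory.Automorphic.UnitaryGroup Literature.NumberTheory.Weil1964
open Literature.NumberTheory.GaloisRepresentations.IsNonarchimedeanLocalField
open Literature.GroupTheory Literature.LinearAlgebra.QuadraticForm
open Literature.RepresentationTheory (SeesawScalar.twist SeesawScalar.twist_apply)

namespace Literature.NumberTheory.GelbartRogawski1991.UnitaryDualPair.LocalSplitting

variable (F : Type) [Field F] [NumberField F] (E : Type) [Field E] [NumberField E] [Algebra F E]
  [Algebra.IsQuadraticExtension F E] (c : E ≃ₐ[F] E)
  {δ : E} (hcδ : c δ = -δ) (hδ : δ ≠ 0) {d : F} (hd : δ * δ = algebraMap F E d)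
  (v : HeightOneSpectrum (𝓞 F))
  [MeasurableSpace (v.adicCompletion F)] [BorelSpace (v.adicCompletion F)]
  (μ : Measure (v.adicCompletion F)) [μ.IsAddHaarMeasure]
  (n : ℕ) {T₀ : Matrix (Fin n) (Fin n) F} (hT₀ : T₀.IsSymm) (hT₀d : IsUnit T₀.det)
  {JD : Matrix (Fin (n + n)) (Fin (n + n)) E} (hJD : JD = (gramD F n T₀).map (algebraMap F E))


omit [MeasurableSpace (v.adicCompletion F)] [BorelSpace (v.adicCompletion F)] in
include hT₀d in
/-- `det 𝕋^𝔻_v` is a unit. [cite: HarrisKudlaSweet1996, §1 (1.9)] -/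
theorem isUnit_det_localGram_gramD : IsUnit (localGram F (n + n) (gramD F n T₀) v).det :=
  UnitaryGroup.isUnit_det_map (algebraMap F (v.adicCompletion F)) (isUnit_det_gramD F n hT₀d)

/-! ## §1 On `P_Δ` the Leray section at `ℓ_Δ` is the conjugated Levi operator -/

/-- **On the Siegel parabolic `P_Δ`, Rao's Leray section at `ℓ_Δ` IS the conjugated Levi operator**: let `r` be a
normalised implementer section of the doubled Schrödinger model with multiplier `c^{ψ_v(½·)}_{ℓ_Δ}`, `E ∈ Sp(𝕎^𝔻_v)`,
`Γ` an implementer of `E`, and `h ∈ Sp(𝕎^𝔻_v)` with `h ℓ_Δ = ℓ_Δ` and `E h E⁻¹ = m(B)` a transported Siegel Levi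
element. Then `r(h) Φ = Γ⁻¹ (leviOpPi (x ↦ B x) (Γ Φ))` — `h` fixes both `ℓ_Δ` and `E⁻¹ ℓ_Y`, the two Leray
sections agree there, and the one of `E⁻¹ℓ_Y` is the `Γ`-conjugate of the `ℓ_Y`-section, with Levi value `leviOpPi`.
[cite: Rangarao1993, Thm 4.1, Lemma 5.1; MoeglinVignerasWaldspurger1987, Chap. 2 II.6] -/
theorem leraySection_deltaLagrangian_apply_eq_conj_leviOpPi
    (hU : ImplementerUniqueUpToScalar (localSchrodinger F (n + n) (gramD F n T₀) v))
    (r : ImplementerSection (localSchrodinger F (n + n) (gramD F n T₀) v))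
    (hr : ∀ g₁ g₂ : LocalSp F (n + n) (gramD F n T₀) v, r.cocycle hU g₁ g₂ =
      localLeray F (n + n) (gramD F n T₀) (isUnit_det_gramD F n hT₀d) v μ ((adeleAddCharAt F v).mulShift (⅟(2 : (v.adicCompletion F))))
        (isContinuousNontrivial_adeleAddCharAt_half F v) (deltaLagrangian F v n)
        (deltaLagrangian_orthogonal F v n T₀ hT₀d) g₁ g₂)
    (E' : LocalSp F (n + n) (gramD F n T₀) v) (Γ : (SchwartzBruhat (Fin (n + n) → v.adicCompletion F)) ≃ₗ[ℂ] (SchwartzBruhat (Fin (n + n) →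
        v.adicCompletion F)))
    (hΓ : Implements (localSchrodinger F (n + n) (gramD F n T₀) v) (ofSymplectic _ E') Γ)
    (h : LocalSp F (n + n) (gramD F n T₀) v)
    (hh : (deltaLagrangian F v n).map (toLin F v h) = deltaLagrangian F v n)
    (B : GL (Fin (n + n)) (v.adicCompletion F))
    (hB : E' * h * E'⁻¹ = transportSp (localGram F (n + n) (gramD F n T₀) v)
      (isUnit_det_localGram_gramD F v n hT₀d) (levi B))
    (Φ : (SchwartzBruhat (Fin (n + n) → v.adicCompletion F))) : r h Φ = Γ.symm (leviOpPi (glEquiv B) (Γ Φ)) := by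
  have hψ := isContinuousNontrivial_adeleAddCharAt F v
  have hTK := isUnit_det_localGram_gramD F v n hT₀d
  haveI : Nontrivial (SchwartzBruhat (Fin (n + n) → v.adicCompletion F)) := nontrivial_schwartzBruhat_pi
  haveI : CharZero (v.adicCompletion F) := charZero_of_injective_algebraMap (algebraMap F (v.adicCompletion F)).injective
  -- the Leray section at `ℓ_Y`
  obtain ⟨hU', rY, hrY⟩ := exists_leraySection_half F (n + n) (gramD F n T₀) (isUnit_det_gramD F n hT₀d) v μ
    (lagrangianY F (n + n) v) (orthogonal_lagrangianY F (n + n) (gramD F n T₀) v (isUnit_det_gramD F n hT₀d))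
  have hrY' : rY.cocycle hU = lerayCentralCocycle μ (isContinuousNontrivial_mulShift_half hψ)
      (isAlt_alt_polar_gram (localGram F (n + n) (gramD F n T₀) v))
      (nondegenerate_alt_polar_gram (localGram F (n + n) (gramD F n T₀) v) hTK)
      (orthogonal_lagrangianY F (n + n) (gramD F n T₀) v (isUnit_det_gramD F n hT₀d)) :=
    CentralCocycle.ext fun g₁ g₂ => hrY g₁ g₂
  have hr' : r.cocycle hU = lerayCentralCocycle μ (isContinuousNontrivial_mulShift_half hψ)
      (isAlt_alt_polar_gram (localGram F (n + n) (gramD F n T₀) v))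
      (nondegenerate_alt_polar_gram (localGram F (n + n) (gramD F n T₀) v) hTK)
      (deltaLagrangian_orthogonal F v n T₀ hT₀d) :=
    CentralCocycle.ext fun g₁ g₂ => hr g₁ g₂
  -- the `Γ`-conjugated section: Leray-normalised at `E⁻¹ ℓ_Y`
  set r₂ := rY.conjBy E' Γ hΓ with hr₂_def
  have hℓ₂ : LinearMap.BilinForm.orthogonal (alt (polar (localPairing F (n + n) (gramD F n T₀) v)))
      ((lagrangianY F (n + n) v).map (toLin F v E'⁻¹)) = (lagrangianY F (n + n) v).map (toLin F v E'⁻¹) :=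
    orthogonal_map_symplectic_eq_self (nondegenerate_alt_polar F (n + n) (gramD F n T₀) v (isUnit_det_gramD F n hT₀d))
      (orthogonal_lagrangianY F (n + n) (gramD F n T₀) v (isUnit_det_gramD F n hT₀d)) E'⁻¹
  have hr₂ : r₂.cocycle hU = lerayCentralCocycle μ (isContinuousNontrivial_mulShift_half hψ)
      (isAlt_alt_polar_gram (localGram F (n + n) (gramD F n T₀) v))
      (nondegenerate_alt_polar_gram (localGram F (n + n) (gramD F n T₀) v) hTK) hℓ₂ := by
    refine CentralCocycle.ext fun g₁ g₂ => Units.ext ?_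
    rw [hr₂_def, ImplementerSection.cocycle_conjBy rY hU E' Γ hΓ, hrY']
    change lerayCocycle ((adeleAddCharAt F v).mulShift (⅟(2 : (v.adicCompletion F)))) μ (alt (polar (localPairing F (n + n) (gramD F n T₀) v)))
        (lagrangianY F (n + n) v) ((E' * g₁ * E'⁻¹ : LocalSp F (n + n) (gramD F n T₀) v) : _ ≃ₗ[(v.adicCompletion F)] _)
        ((E' * g₂ * E'⁻¹ : LocalSp F (n + n) (gramD F n T₀) v) : _ ≃ₗ[(v.adicCompletion F)] _) =
      lerayCocycle ((adeleAddCharAt F v).mulShift (⅟(2 : (v.adicCompletion F)))) μ (alt (polar (localPairing F (n + n) (gramD F n T₀) v)))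
        ((lagrangianY F (n + n) v).map (toLin F v E'⁻¹)) (g₁ : _ ≃ₗ[(v.adicCompletion F)] _) (g₂ : _ ≃ₗ[(v.adicCompletion F)] _)
    -- `c_{ℓ_Y}(E g₁ E⁻¹, E g₂ E⁻¹) = c_{E⁻¹ℓ_Y}(g₁, g₂)`
    have key := lerayCocycle_conj μ ((E'⁻¹ : LocalSp F (n + n) (gramD F n T₀) v) : ((Fin (n + n) → v.adicCompletion F) × (Fin (n + n) →
        v.adicCompletion F)) ≃ₗ[(v.adicCompletion F)] ((Fin (n + n) → v.adicCompletion F) × (Fin (n + n) → v.adicCompletion F))) (E'⁻¹).2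
      (isContinuousNontrivial_mulShift_half hψ) (lagrangianY F (n + n) v)
      ((E' * g₁ * E'⁻¹ : LocalSp F (n + n) (gramD F n T₀) v) : ((Fin (n + n) → v.adicCompletion F) × (Fin (n + n) → v.adicCompletion F))
          ≃ₗ[(v.adicCompletion F)] ((Fin (n + n) → v.adicCompletion F) × (Fin (n + n) → v.adicCompletion F)))
      ((E' * g₂ * E'⁻¹ : LocalSp F (n + n) (gramD F n T₀) v) : ((Fin (n + n) → v.adicCompletion F) × (Fin (n + n) → v.adicCompletion F))
          ≃ₗ[(v.adicCompletion F)] ((Fin (n + n) → v.adicCompletion F) × (Fin (n + n) → v.adicCompletion F)))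
    have e : ∀ g : LocalSp F (n + n) (gramD F n T₀) v,
        ((E'⁻¹ : LocalSp F (n + n) (gramD F n T₀) v) : ((Fin (n + n) → v.adicCompletion F) × (Fin (n + n) → v.adicCompletion F)) ≃ₗ[(v.adicCompletion
            F)] ((Fin (n + n) → v.adicCompletion F) × (Fin (n + n) → v.adicCompletion F))).symm ≪≫ₗ
          ((E' * g * E'⁻¹ : LocalSp F (n + n) (gramD F n T₀) v) : ((Fin (n + n) → v.adicCompletion F) × (Fin (n + n) → v.adicCompletion F))
              ≃ₗ[(v.adicCompletion F)] ((Fin (n + n) → v.adicCompletion F) × (Fin (n + n) → v.adicCompletion F))) ≪≫ₗ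
          ((E'⁻¹ : LocalSp F (n + n) (gramD F n T₀) v) : ((Fin (n + n) → v.adicCompletion F) × (Fin (n + n) → v.adicCompletion F))
              ≃ₗ[(v.adicCompletion F)] ((Fin (n + n) → v.adicCompletion F) × (Fin (n + n) → v.adicCompletion F))) = ((g : LocalSp F (n + n) (gramD F
              n T₀) v) : ((Fin (n + n) → v.adicCompletion F) × (Fin (n + n) → v.adicCompletion F)) ≃ₗ[(v.adicCompletion F)] ((Fin (n + n) →
              v.adicCompletion F) × (Fin (n + n) → v.adicCompletion F))) := fun g => by
      refine LinearEquiv.ext fun x => ?_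
      simp only [LinearEquiv.trans_apply, Subgroup.coe_mul, Subgroup.coe_inv, LinearEquiv.mul_apply,
        LinearEquiv.coe_inv, LinearEquiv.symm_apply_apply]
      exact congrArg ((g : LocalSp F (n + n) (gramD F n T₀) v) : ((Fin (n + n) → v.adicCompletion F) × (Fin (n + n) → v.adicCompletion F))
          ≃ₗ[(v.adicCompletion F)] ((Fin (n + n) → v.adicCompletion F) × (Fin (n + n) → v.adicCompletion F)))
        (((E' : LocalSp F (n + n) (gramD F n T₀) v) : ((Fin (n + n) → v.adicCompletion F) × (Fin (n + n) → v.adicCompletion F)) ≃ₗ[(v.adicCompletion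
            F)] ((Fin (n + n) → v.adicCompletion F) × (Fin (n + n) → v.adicCompletion F))).symm_apply_apply x)
    rw [e, e] at key
    exact key.symm
  -- `h` fixes `E⁻¹ ℓ_Y`
  have hmB : (lagrangianY F (n + n) v).map (toLin F v (transportSp (localGram F (n + n) (gramD F n T₀) v)
      (isUnit_det_localGram_gramD F v n hT₀d) (levi B))) = lagrangianY F (n + n) v :=
    map_transportSp_levi_prod_bot_top (localGram F (n + n) (gramD F n T₀) v) hTK B
  have h₂ : ((lagrangianY F (n + n) v).map (toLin F v E'⁻¹)).map (toLin F v h) =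
      (lagrangianY F (n + n) v).map (toLin F v E'⁻¹) := by
    have eh : h = E'⁻¹ * (E' * h * E'⁻¹) * E' := by group
    conv_lhs => rw [eh, hB]
    rw [← map_coe_mul, mul_inv_cancel_right, map_coe_mul, hmB]
  -- two Leray sections agree on the common stabiliser
  have hagree := leraySection_apply_eq_of_map_eq μ
    (monoidHom_symplecticGroup_gram_eq_one (localGram F (n + n) (gramD F n T₀) v) hTK)
    (isContinuousNontrivial_mulShift_half hψ) (isAlt_alt_polar_gram (localGram F (n + n) (gramD F n T₀) v))
    (nondegenerate_alt_polar_gram (localGram F (n + n) (gramD F n T₀) v) hTK)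
    (deltaLagrangian_orthogonal F v n T₀ hT₀d) hℓ₂ hU r r₂ hr' hr₂ h hh h₂
  -- the value of the conjugated section
  rw [hagree, hr₂_def, ImplementerSection.conjBy_apply, hB,
    leraySection_apply_transportSp_levi (localGram F (n + n) (gramD F n T₀) v) hTK
      (isLocallyConstant_of_isContinuousNontrivial hψ) (continuous_toLinearMap₂'_left (localGram F (n + n) (gramD F n T₀) v))
      μ hψ hU rY (orthogonal_lagrangianY F (n + n) (gramD F n T₀) v (isUnit_det_gramD F n hT₀d)) hrY' B]

/-! ## §2 The Weil representation of the split datum in the mixed model -/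

/-- **THE WEIL REPRESENTATION OF THE SPLIT DATUM IS THE MIXED MODEL TWISTED BY `χ_w(det)⁻¹`.** Let
`D = localSplittingDatumSplit … χv` be the split datum of the doubled group at `v` (`T₀` diagonal, `0 < n`, `χv` a
split pair trivial near `1`), `E ∈ Sp(𝕎^𝔻_v)` with `ι^𝔻_v(κ_A) = E⁻¹ m(A⁻ᵀ) E` for every `A ∈ GL_{n+n}(F_v)`
(`κ_A ∈ H(F_v)` of `w`-component `ι_w(A)`; e.g. `E = J_v γ_w`), and `Γ` ANY implementer of `E` on
`𝒮(F_v^{n+n})`. Then for all `A` and `Φ`: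

  `ω_D(κ_A) Φ = (χ_w (det ι_w(A)))⁻¹ • Γ⁻¹ (leviOpPi (x ↦ A⁻ᵀ x) (Γ Φ))`.

[cite: Kudla1994, Thm 3.1; HarrisKudlaSweet1996, §1 (1.15)–(1.16); MoeglinVignerasWaldspurger1987, Chap. 3 III.1] -/
theorem localOmega_localSplittingDatumSplit_symm_map (w : PlacesOver E v) (hw : c • w.1 ≠ w.1)
    (χv : ∀ w : PlacesOver E v, (w.1.adicCompletion E)ˣ →* ℂˣ) (hχ : IsSplitPair F E c v w χv)
    (hχ1 : IsTrivialNearOne F E v w (χv w))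
    (hn : 0 < n) (t : Fin n → F) (hT₀t : T₀ = Matrix.diagonal t)
    (hc : c ≠ 1) (hJc : (JD.map c)ᵀ = JD) (hJw : IsUnit (placeForm JD w.1))
    (E' : LocalSp F (n + n) (gramD F n T₀) v)
    (hE' : ∀ A : GL (Fin (n + n)) (v.adicCompletion F), iotaD F E c hcδ hδ hd v n hT₀ hJD
      ((localPiSplitEquiv c JD hc hJc w hw hJw).symm (Matrix.GeneralLinearGroup.map (toPlace v w) A)) =
        E'⁻¹ * transportSp (localGram F (n + n) (gramD F n T₀) v) (isUnit_det_localGram_gramD F v n hT₀d)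
          (levi (GLn.contragredient A)) * E')
    (Γ : (SchwartzBruhat (Fin (n + n) → v.adicCompletion F)) ≃ₗ[ℂ] (SchwartzBruhat (Fin (n + n) → v.adicCompletion F))) (hΓ : Implements
        (localSchrodinger F (n + n) (gramD F n T₀) v) (ofSymplectic _ E') Γ)
    (A : GL (Fin (n + n)) (v.adicCompletion F)) (Φ : (SchwartzBruhat (Fin (n + n) → v.adicCompletion F))) :
    (localSplittingDatumSplit F E c hcδ hδ hd v μ n hT₀ hT₀d hJD w hw χv hχ1).localOmega
        ((localPiSplitEquiv c JD hc hJc w hw hJw).symm (Matrix.GeneralLinearGroup.map (toPlace v w) A)) Φ =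
      (((χv w (Matrix.GeneralLinearGroup.det (Matrix.GeneralLinearGroup.map
          (toPlace v w : (v.adicCompletion F) →+* w.1.adicCompletion E) A)))⁻¹ : ℂˣ) : ℂ) •
        Γ.symm (leviOpPi (glEquiv (GLn.contragredient A)) (Γ Φ)) := by
  classical
  haveI : Nontrivial (SchwartzBruhat (Fin (n + n) → v.adicCompletion F)) := nontrivial_schwartzBruhat_pi
  set D := localSplittingDatumSplit F E c hcδ hδ hd v μ n hT₀ hT₀d hJD w hw χv hχ1 with hD_def
  -- `ι_w : F_v ≃+* E_w` (onto at a split place)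
  let ιw : (v.adicCompletion F) ≃+* w.1.adicCompletion E :=
    RingEquiv.ofBijective (toPlace v w) ⟨(toPlace v w).injective, toPlace_surjective F E c hcδ hδ hd v w hw⟩
  -- the `w`-component of `g ∈ H(F_v)` read in `GL_{n+n}(F_v)`
  let Aof : UnitaryGroup.localPi E c (n + n) JD v →* GL (Fin (n + n)) (v.adicCompletion F) :=
    (Matrix.GeneralLinearGroup.map (ιw.symm : w.1.adicCompletion E ≃+* (v.adicCompletion F)).toRingHom).comp
      (localPiSplitEquiv c JD hc hJc w hw hJw).toMulEquiv.toMonoidHom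
  have hκA : ∀ g, (localPiSplitEquiv c JD hc hJc w hw hJw).symm
      (Matrix.GeneralLinearGroup.map (toPlace v w) (Aof g)) = g := by
    intro g
    apply (localPiSplitEquiv c JD hc hJc w hw hJw).injective
    rw [ContinuousMulEquiv.apply_symm_apply]
    refine Units.ext (Matrix.ext fun i j => ?_)
    exact ιw.apply_symm_apply _
  have hAκ : ∀ A, Aof ((localPiSplitEquiv c JD hc hJc w hw hJw).symm
      (Matrix.GeneralLinearGroup.map (toPlace v w) A)) = A := by
    intro A
    change Matrix.GeneralLinearGroup.map _
      (localPiSplitEquiv c JD hc hJc w hw hJw ((localPiSplitEquiv c JD hc hJc w hw hJw).symm _)) = A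
    rw [ContinuousMulEquiv.apply_symm_apply]
    refine Units.ext (Matrix.ext fun i j => ?_)
    exact ιw.symm_apply_apply _
  -- the conjugated Levi operators as a second section over `ι^𝔻_v`
  let L : GL (Fin (n + n)) (v.adicCompletion F) →* ((SchwartzBruhat (Fin (n + n) → v.adicCompletion F)) ≃ₗ[ℂ] (SchwartzBruhat (Fin (n + n) →
      v.adicCompletion F))) :=
    MonoidHom.mk' (fun A => leviOpPi (glEquiv (GLn.contragredient A)))
      (Liu2021.SplitPlaceMixedModel.leviOpPi_contragredient_mul F (n + n) v)
  let M : UnitaryGroup.localPi E c (n + n) JD v →* ((SchwartzBruhat (Fin (n + n) → v.adicCompletion F)) ≃ₗ[ℂ] (SchwartzBruhat (Fin (n + n) →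
      v.adicCompletion F))) :=
    MonoidHom.mk' (fun g => Γ⁻¹ * L (Aof g) * Γ) (fun g g' => by rw [_root_.map_mul, _root_.map_mul]; group)
  have hM : ∀ g, Implements (localSchrodinger F (n + n) (gramD F n T₀) v)
      (ofSymplectic _ (iotaD F E c hcδ hδ hd v n hT₀ hJD g)) (M g) := by
    intro g
    have hι := hE' (Aof g)
    rw [hκA] at hι
    rw [hι, _root_.map_mul, _root_.map_mul, map_inv]
    exact Implements.mul _ (Implements.mul _ (Implements.inv _ hΓ)
      (implements_transportSp_levi_leviOpPi _ _ _ _ _)) hΓ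
  let s' : UnitaryGroup.localPi E c (n + n) JD v →* LocalMp F (n + n) (gramD F n T₀) v := MonoidHom.mk'
    (fun g => ⟨(iotaD F E c hcδ hδ hd v n hT₀ hJD g, M g), (mem_MpPsi _ _).2 (hM g)⟩)
    (fun g g' => Subtype.ext (Prod.ext (_root_.map_mul _ g g') (_root_.map_mul M g g')))
  have hs' : ∀ g, MpPsi.proj _ (D.localSplitting g) = MpPsi.proj _ (s' g) :=
    fun g => (D.proj_localSplitting g).trans rfl
  obtain ⟨η, hη⟩ := MpPsi.exists_twist_toRep_comp_of_proj_eq (localSchrodinger F (n + n) (gramD F n T₀) v)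
    D.hU s' D.localSplitting hs'
  -- the mixed model with the (as yet unknown) character `η`
  have hmodel : ∀ (g : UnitaryGroup.localPi E c (n + n) JD v) (Ψ : (SchwartzBruhat (Fin (n + n) → v.adicCompletion F))),
      D.localOmega g Ψ = ((η g : ℂˣ) : ℂ) • Γ.symm (L (Aof g) (Γ Ψ)) := by
    intro g Ψ
    change ((MpPsi.toRep (localSchrodinger F (n + n) (gramD F n T₀) v)).comp D.localSplitting) g Ψ = _
    rw [hη, SeesawScalar.twist_apply, MonoidHom.comp_apply, MpPsi.toRep_apply]
    rfl
  -- on `P_Δ`: `η(p) · χ_w(det p_w) = 1`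
  obtain ⟨Φ₀, hΦ₀⟩ := exists_ne (0 : (SchwartzBruhat (Fin (n + n) → v.adicCompletion F)))
  have hP : ∀ p : UnitaryGroup.localPi E c (n + n) JD v, IsSiegelDelta F E c hcδ hδ hd v n hT₀ hJD p →
      η p * χv w (Matrix.GeneralLinearGroup.det ((p : UnitaryGroup.LocalGLPi E (n + n) v) w)) = 1 := by
    intro p hp
    -- `β(p) = χ_w(det p_w)`
    have hβ : D.beta p = χv w (Matrix.GeneralLinearGroup.det ((p : UnitaryGroup.LocalGLPi E (n + n) v) w)) := by
      change betaSplitDoubled F E c hcδ hδ hd v μ n hT₀ hT₀d hJD w hw (L0D F v μ n hT₀d).hψ' χv p = _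
      rw [L1s_parabolic F E c hcδ hδ hd v μ n hT₀ hT₀d hJD w hw (L0D F v μ n hT₀d).hψ' χv hχ p hp,
        chi_det_eq_chiDet F E c hcδ hδ hd v n hT₀ hT₀d hJD w hw χv hχ p hp]
    -- `r_Δ(ι p) = Γ⁻¹ L Γ` on `P_Δ` (§1)
    have hB : E' * iotaD F E c hcδ hδ hd v n hT₀ hJD p * E'⁻¹ =
        transportSp (localGram F (n + n) (gramD F n T₀) v) (isUnit_det_localGram_gramD F v n hT₀d)
          (levi (GLn.contragredient (Aof p))) := by
      have hι := hE' (Aof p)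
      rw [hκA] at hι
      rw [hι]
      group
    have hr := leraySection_deltaLagrangian_apply_eq_conj_leviOpPi F v μ n hT₀d D.hU D.r
      (L0D F v μ n hT₀d).cocycle_eq E' Γ hΓ (iotaD F E c hcδ hδ hd v n hT₀ hJD p) hp (GLn.contragredient (Aof p)) hB Φ₀
    -- compare the two expressions of `ω_D(p) Φ₀`
    have h1 := hmodel p Φ₀
    rw [D.localOmega_apply, Units.smul_def, hr, hβ] at h1
    have hne : Γ.symm (L (Aof p) (Γ Φ₀)) ≠ 0 :=
      Γ.symm.map_ne_zero_iff.2 ((L (Aof p)).map_ne_zero_iff.2 (Γ.map_ne_zero_iff.2 hΦ₀))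
    have hsc := smul_left_injective ℂ hne h1
    -- `hsc : ((χ_w(det p_w))⁻¹ : ℂ) = η p`
    have hηp : η p = (χv w (Matrix.GeneralLinearGroup.det ((p : UnitaryGroup.LocalGLPi E (n + n) v) w)))⁻¹ :=
      Units.ext hsc.symm
    rw [hηp, inv_mul_cancel]
  -- a character of `H(F_v)` trivial on `P_Δ` is trivial
  let χdet : UnitaryGroup.localPi E c (n + n) JD v →* ℂˣ :=
    (χv w).comp (Matrix.GeneralLinearGroup.det.comp (localPiSplitEquiv c JD hc hJc w hw hJw).toMulEquiv.toMonoidHom)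
  have hχdet : ∀ g : UnitaryGroup.localPi E c (n + n) JD v,
      χdet g = χv w (Matrix.GeneralLinearGroup.det ((g : UnitaryGroup.LocalGLPi E (n + n) v) w)) := fun g => rfl
  have hηχ : η * χdet = 1 :=
    eq_one_of_forall_isSiegelDelta_eq_one_of_split F E c hcδ hδ hd v n hn t hT₀t hT₀ hT₀d hJD w hw (η * χdet)
      fun p hp => by rw [MonoidHom.mul_apply, hχdet]; exact hP p hp
  have hκw : (((localPiSplitEquiv c JD hc hJc w hw hJw).symm
      (Matrix.GeneralLinearGroup.map (toPlace v w) A) : UnitaryGroup.localPi E c (n + n) JD v) :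
        UnitaryGroup.LocalGLPi E (n + n) v) w = Matrix.GeneralLinearGroup.map (toPlace v w : (v.adicCompletion F) →+* w.1.adicCompletion E) A :=
    (localPiSplitEquiv c JD hc hJc w hw hJw).apply_symm_apply _
  have hηA : η ((localPiSplitEquiv c JD hc hJc w hw hJw).symm (Matrix.GeneralLinearGroup.map (toPlace v w) A)) =
      (χv w (Matrix.GeneralLinearGroup.det (Matrix.GeneralLinearGroup.map
        (toPlace v w : (v.adicCompletion F) →+* w.1.adicCompletion E) A)))⁻¹ := by
    have h := DFunLike.congr_fun hηχ
      ((localPiSplitEquiv c JD hc hJc w hw hJw).symm (Matrix.GeneralLinearGroup.map (toPlace v w) A))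
    rw [MonoidHom.mul_apply, MonoidHom.one_apply, hχdet, hκw] at h
    exact eq_inv_of_mul_eq_one_left h
  have final := hmodel ((localPiSplitEquiv c JD hc hJc w hw hJw).symm (Matrix.GeneralLinearGroup.map (toPlace v w) A)) Φ
  rw [hAκ, hηA] at final
  exact final

end Literature.NumberTheory.GelbartRogawski1991.UnitaryDualPair.LocalSplitting

end
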